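/-
Copyright (c) 2026 the pub-hodgecm-mathlib formalisation cell (harness21).  Prover seat hodgecm-mathlib-LH7-p08 (g3), req620 Track A «(D-RAM) FOUR-FRAME» squad
(STAGE-1b, row (2) of the piece `f_{T₊}`, the (β₂) road (R-36) «PURE-CELL LEDGER», K6 road; K6 desk LH4-p16 (g3) DESK WORD #1 (b) «NEXT = K6-(d′) THE CLASS SPLIT»;
the lane-B twin of LH4-p16 (g2) MECH-K3 d766981c §2 «`q_A = −q_H`» and §3 «one-literal towers»), 2026-09-05.
-/
import Summits.HodgeConjecture.HodgeConjecture.Theorems.F0P3cDyRamRowCellSocketReads           -- ★ p863914 (LH4-p16 (g2)) §0 `exists_indexTwo_letters`; brings ★ p863859 `fixedNorm_mul ∕ _inv ∕ _mul_iff ∕ _map_iff ∕ _mul_iff_iff`, ★ Lit `exists_mul_map_eq_of_fixed_of_v_sub_one_le_pred`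
import Summits.HodgeConjecture.HodgeConjecture.Theorems.F0P3cDyRamTypeTwoAnisotropyOfFrame      -- ★ (LH4-p11 (g5)): `det_block_diagonal`; brings ★ Lit `det_formCongr`, `det_antidiagonal_three`, `pairing_single_single`, `formCongr`, `StdForm`
import Literature.NumberTheory.Automorphic.UnitaryLatticeTreeSelfDualTransitiveTwo              -- ★ Lit: `det_antidiagonal_two`
import HarnessLib

/-!
# Crux `H413`, line LH4 «(D-RAM) FOUR-FRAME» — STAGE-1b, row (2), the (β₂) road (R-36), K6-(d′): «THE CLASS SPLIT OF THE DIGIT LINE» — the two literals' class conjuncts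
# are COMPLEMENTARY on every sphere point (the hyperbolic and the anisotropic frame scalars differ by the non-norm class, by determinants of the frame equation), and the
# FAR towers (`|V₀|·|ξ₀| ≥ exp(2d − 1)`, cells `b + 2i` with `d ≤ i`) are entirely of the HYPERBOLIC class

Cell `hodgecm-mathlib` (D-0151), FLOOR 0, crux item H413 = `stmt-HodgeConjecture-24833`, route of record `HCCMUnconditional`; squad F0∕P3c∕LH7 (hand lent to the LH4 β₂ board);
lane `--supports stmt-HodgeConjecture-24833 --as helper` (count-neutral; pays NO tier-0 row).  THEOREMS ONLY (no `def`, no instance, no notation, no `sorry`, default heartbeats);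
★-only imports; states NO law; (β₂) stays a HYPOTHESIS.

WHAT (K6 desk LH4-p16 (g3) DESK WORD #1 (b); consumers: the K6-(e) spine ★ p864340 `…CoreOfPerCellLaws.coreWindow_of_perCellLaws` letters `hdisjHA`, `hcov`, and ★ p864238 §2′ `hwinA`;
LH4-p18 (g4)'s tower-cell file F1).  CURRENCY = the CLASS conjunct of ★ p863983's literal predicate for the frame scalar `h_t`:
  `CLASS_{h_t} V₀ :≡ ∃ e : M, ρ e = e ∧ e * Θ e = (κ₀ + jE V₀·ξ₀) · ρ(κ₀ + jE V₀·ξ₀) ∕ (h_t · ρ h_t)`     (`𝒩 := {eΘe : ρe = e}`),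
in the CORE frame of ‹CORE-3› ∕ ‹CORE-ODD.v1›: the H-literal `(φ, h)` is a line model of the hyperbolic plane `(StdForm.antidiagonal 2).over E` (`_hform`), the A-literal `(φ′, h′)` one of
`Matrix.diagonal dg` (`_hform'`), with the frame equation `_hA : formCongr σ P₁ ((StdForm.antidiagonal 3).over E) = block(diagonal dg, η)` and `_hηN : ¬ ∃ t, t·σt = η`.
* §1 `fixedNorm_div_iff_not_fixedNorm_div` — INDEX TWO: for doubly-fixed non-zero `a₁, a₂, Q` with `a₂∕a₁ ∉ 𝒩`, `Q∕a₁ ∈ 𝒩 ↔ Q∕a₂ ∉ 𝒩` (★ p863859 `fixedNorm_mul_iff_iff` on the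
  dichotomy letters of ★ p863914 §0).
* §2 `map_det_eq_of_lineModel` — THE GRAM DETERMINANT OF A LINE MODEL: from `_hform` ALONE, `jE(det H₂) = hρh · ΔΘΔ` with the ρ-ANTI element
  `Δ := φe₀·ρ(φe₁) − φe₁·ρ(φe₀)` (`map_lineDisc_eq_neg`); `normRho_mul_normTheta_lineDisc_eq_neg_one` (H-frame: `hρh·ΔΘΔ = −1`, ★ `det_antidiagonal_two`),
  `normRho_mul_normTheta_lineDisc_eq_map_prod` (A-frame: `h′ρh′·Δ′ΘΔ′ = jE(dg₀dg₁)`).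
* §3 `not_fixedNorm_frameRatio` — THE TWO FRAMES DIFFER BY THE NON-NORM CLASS: `(h′ρh′)∕(hρh) ∉ 𝒩`.  Determinants of `_hA` give `dg₀·η·dg₁ = −N(det P₁)` (★ `det_formCongr`,
  ★ `det_antidiagonal_three`, ★ `det_block_diagonal`), so with §2 `jE η = N_Θ(jE det P₁)·(hρh∕h′ρh′)·N_Θ(Δ∕Δ′)`; were `h′ρh′∕hρh ∈ 𝒩`, `η` would be a norm (★ `fixedNorm_map_iff`).
  (MECH-K3 §2's «`q_A = −q_H`» as a theorem; the isotropy letter `_hhyper` is not needed.)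
* §4 HEAD (d′1) `classClause_iff_not_classClause` — on EVERY point `κ = κ₀ + jE V₀·ξ₀` of the line (κ₀ of ρ-trace one and Θ-fixed, ξ₀ ρ-anti and Θ-fixed, `σV₀ = V₀`):
  `CLASS_{h′}(V₀) ↔ ¬ CLASS_h(V₀)`; `classClause_or` (every digit is H-class or A-class); Finset `disjoint_filter_class_filter_class` = the spine's `hdisjHA` for ANY cell predicates
  and labels.
* §5 HEAD (d′2) `classClause_of_far` — FAR TOWERS ARE HYPERBOLIC-CLASS: with `|κ₀| = 1` and `exp(2d − 1) ≤ |V₀|·|ξ₀|`: `CLASS_h(V₀)`.  Mechanism: `Q(κ) = −(jE V₀·ξ₀)²·u` with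
  `u − 1 = −(κ₀ρκ₀ − jE V₀·ξ₀·(κ₀ − ρκ₀)) ∕ (jE V₀·ξ₀)²`, `|u − 1| ≤ 1∕|V₀ξ₀| ≤ |ϖE|^{2d−1}` ⇒ `u ∈ 𝒩` (★ Lit `exists_mul_map_eq_of_fixed_of_v_sub_one_le_pred` through `jE`); §2 gives
  `−1∕(hρh) = ΔΘΔ`, so `Q∕(hρh) = u · (jE V₀)Θ(jE V₀) · (ξ₀Δ)Θ(ξ₀Δ)` with `ξ₀Δ` ρ-FIXED (anti × anti) — three members of `𝒩`; `not_classClause'_of_far` (× §4): NO A-class digit on a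
  far tower — in the one chart of ★ p864361 §7 (`|ξ₀| = exp 2N`, cell `b + 2i ↔ |V₀|·|ξ₀| = exp 2i`) the cells `i ≥ d` carry no A-digit, so `IA = range (min (…) d)` covers (`hwinA`).
WHAT IS NOT CLAIMED: the class MIX on the near shells `i < d` (both classes occur — the (hF)∕‹K6-(f′)› business), any count, the label character, (hI)(hV)(hP)(hF) (★).
HONEST LABEL.  Count-neutral field algebra; nothing printed is asserted; no census law is stated; `HC_CM` is proved only modulo the 7 printed citations (2 remaining named inputs:
hLiu418 = `stmt-HodgeConjecture-24832`, h413 = `stmt-HodgeConjecture-24833`) until rung 0 closes.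
## References
* [Jacobowitz1962] R. Jacobowitz, *Hermitian forms over local fields*, Amer. J. Math. 84 (1962): §3 (the discriminant `det H mod N(E^×)` classifies; hyperbolic iff `−det ∈ N`), §4 (lattices).
* [Serre1979] J.-P. Serre, *Local Fields*, GTM 67 (1979): Ch. V §3 Prop. 5, Cor. 2–3 pp. 84–86 (norm index two; norms near `1`), Ch. XV §2 (conductor).
* [Flicker1998UnitaryFL] Y. Z. Flicker, *Elementary proof of the fundamental lemma for a unitary group*, Canad. J. Math. 50 (1998): Prop. 7 p. 84 (type RamK census by classes).
* [Kottwitz1986BaseChangeUnits] R. E. Kottwitz, *Base change for unit elements of Hecke algebras*, Compositio Math. 60 (1986): §1 pp. 240–241 (fixed-lattice counts as orbital integrals).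
-/

set_option autoImplicit false

noncomputable section

namespace Summit.HodgeConjecture.HodgeConjecture.Cruxes.H413.F0P3cDyRamRowCellDigitClassSplit

open scoped Valued WithZero Matrix MatrixGroups
open WithZero Finset
open Literature.NumberTheory.Automorphic Literature.NumberTheory.Automorphic.UnitaryGroup Literature.NumberTheory.Automorphic.UnitaryLatticeTree
open Literature.NumberTheory.Automorphic.UnitaryThreeFourFrame (IsRamifiedQuadraticDatum)
open Literature.NumberTheory.LocalFields.WildQuadraticDatum (exists_mul_map_eq_of_fixed_of_v_sub_one_le_pred)
open Summit.HodgeConjecture.HodgeConjecture.Cruxes.H413.F0P3cDyRamRowVertexPopulationRead (fixedNorm_mul fixedNorm_inv fixedNorm_mul_iff fixedNorm_map_iff fixedNorm_mul_iff_iff)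
open Summit.HodgeConjecture.HodgeConjecture.Cruxes.H413.F0P3cDyRamRowCellSocketReads (exists_indexTwo_letters)
open Summit.HodgeConjecture.HodgeConjecture.Cruxes.H413.F0P3cDyRamTypeTwoAnisotropyOfFrame (det_block_diagonal)

variable {E M : Type} [Field E] [Valued E ℤᵐ⁰] [Field M] [Valued M ℤᵐ⁰] {ρ Θ : M →+* M} {α : M}

/-! ## §1 Index two: complementary classes -/

omit [Field E] [Valued E ℤᵐ⁰] [Valued M ℤᵐ⁰] in
/-- **INDEX TWO — COMPLEMENTARY CLASSES.**  `𝒩 = {eΘe : ρe = e}`; index-two letters (a doubly-fixed `c ∉ 𝒩` with the dichotomy «`u ∈ 𝒩` or `c·u ∈ 𝒩`» for non-zero doubly-fixed `u`,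
★ p863914 §0); doubly-fixed non-zero `a₁, a₂, Q` with `a₂ ∕ a₁ ∉ 𝒩`.  THEN `Q ∕ a₁ ∈ 𝒩 ↔ Q ∕ a₂ ∉ 𝒩` (`Q∕a₁ = (Q∕a₂)·(a₂∕a₁)` and ★ `fixedNorm_mul_iff_iff`).
[cite: Serre1979, Ch. V §3 Prop. 5, Cor. 2–3 pp. 84–86] -/
theorem fixedNorm_div_iff_not_fixedNorm_div {c a₁ a₂ Q : M} (hρc : ρ c = c) (hΘc : Θ c = c) (hcn : ¬ ∃ e : M, ρ e = e ∧ e * Θ e = c)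
    (hdich : ∀ u : M, ρ u = u → Θ u = u → u ≠ 0 → (∃ e : M, ρ e = e ∧ e * Θ e = u) ∨ ∃ e : M, ρ e = e ∧ e * Θ e = c * u)
    (hρ₁ : ρ a₁ = a₁) (hΘ₁ : Θ a₁ = a₁) (h₁ : a₁ ≠ 0) (hρ₂ : ρ a₂ = a₂) (hΘ₂ : Θ a₂ = a₂) (h₂ : a₂ ≠ 0)
    (h₁₂ : ¬ ∃ e : M, ρ e = e ∧ e * Θ e = a₂ / a₁) (hρQ : ρ Q = Q) (hΘQ : Θ Q = Q) (hQ : Q ≠ 0) :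
    (∃ e : M, ρ e = e ∧ e * Θ e = Q / a₁) ↔ ¬ ∃ e : M, ρ e = e ∧ e * Θ e = Q / a₂ := by
  have e1 : Q / a₁ = (Q / a₂) * (a₂ / a₁) := by field_simp
  rw [e1, fixedNorm_mul_iff_iff hρc hΘc hcn hdich (by rw [map_div₀, hρQ, hρ₂]) (by rw [map_div₀, hΘQ, hΘ₂]) (div_ne_zero hQ h₂)
    (by rw [map_div₀, hρ₂, hρ₁]) (by rw [map_div₀, hΘ₂, hΘ₁]) (div_ne_zero h₂ h₁)]
  exact ⟨fun h hQ₂ => h₁₂ (h.1 hQ₂), fun h => ⟨fun hQ₂ => absurd hQ₂ h, fun h12 => absurd h12 h₁₂⟩⟩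

/-! ## §2 The Gram determinant of a line model -/

omit [Field E] [Valued E ℤᵐ⁰] [Valued M ℤᵐ⁰] in
/-- The line discriminant `Δ := z₀·ρz₁ − z₁·ρz₀` is `ρ`-ANTI (`ρ² = 1`). [cite: Jacobowitz1962, §3] -/
theorem map_lineDisc_eq_neg (hρρ : ∀ x, ρ (ρ x) = x) (z₀ z₁ : M) : ρ (z₀ * ρ z₁ - z₁ * ρ z₀) = -(z₀ * ρ z₁ - z₁ * ρ z₀) := by
  rw [map_sub, map_mul, map_mul, hρρ, hρρ]; ring

omit [Valued E ℤᵐ⁰] [Valued M ℤᵐ⁰] in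
/-- **THE GRAM DETERMINANT OF A LINE MODEL.**  If `(M; φ, h)` is a line model of the hermitian plane `(E², H₂)` — `jE ⟨x, y⟩_{H₂} = h·Θ(φx)·φy + ρ(h·Θ(φx)·φy)` for all `x, y` — and
`Θρ = ρΘ`, then with `z_a := φ e_a` and `Δ := z₀·ρz₁ − z₁·ρz₀`: `jE(det H₂) = h·ρh·(Δ·ΘΔ)` (expand the `2 × 2` determinant of `Tr_ρ(h·Θz_a·z_b)`: the `ρ`-free and the `ρρ` terms
cancel, the cross terms give `Tr_ρ(hρh·Θz₀·ρΘz₁·Δ) = hρh·Δ·ΘΔ`). [cite: Jacobowitz1962, §3] -/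
theorem map_det_eq_of_lineModel {σ : E →+* E} (H₂ : Matrix (Fin 2) (Fin 2) E) (jE : E →+* M) (φ : (Fin 2 → E) →+ M) {hM : M}
    (hΘρ : ∀ x, Θ (ρ x) = ρ (Θ x)) (hform : ∀ x y, jE (pairing σ H₂ x y) = hM * Θ (φ x) * φ y + ρ (hM * Θ (φ x) * φ y)) :
    jE H₂.det = hM * ρ hM * ((φ (Pi.single 0 1) * ρ (φ (Pi.single 1 1)) - φ (Pi.single 1 1) * ρ (φ (Pi.single 0 1))) *
      Θ (φ (Pi.single 0 1) * ρ (φ (Pi.single 1 1)) - φ (Pi.single 1 1) * ρ (φ (Pi.single 0 1)))) := by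
  have hρΘ : ∀ x, ρ (Θ x) = Θ (ρ x) := fun x => (hΘρ x).symm
  have hent : ∀ a b : Fin 2, jE (H₂ a b) = hM * Θ (φ (Pi.single a 1)) * φ (Pi.single b 1) + ρ (hM * Θ (φ (Pi.single a 1)) * φ (Pi.single b 1)) :=
    fun a b => by rw [← pairing_single_single σ H₂ a b, hform]
  rw [Matrix.det_fin_two, map_sub, map_mul, map_mul, hent, hent, hent, hent]
  simp only [map_mul, map_sub, hρΘ]
  ring

omit [Valued E ℤᵐ⁰] [Valued M ℤᵐ⁰] in
/-- **H-FRAME: `hρh·ΔΘΔ = −1`** — §2 at the hyperbolic plane `(StdForm.antidiagonal 2).over E` (★ `det_antidiagonal_two`). [cite: Jacobowitz1962, §3] -/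
theorem normRho_mul_normTheta_lineDisc_eq_neg_one {σ : E →+* E} (jE : E →+* M) (φ : (Fin 2 → E) →+ M) {hM : M} (hΘρ : ∀ x, Θ (ρ x) = ρ (Θ x))
    (hform : ∀ x y, jE (pairing σ ((StdForm.antidiagonal 2).over E) x y) = hM * Θ (φ x) * φ y + ρ (hM * Θ (φ x) * φ y)) :
    hM * ρ hM * ((φ (Pi.single 0 1) * ρ (φ (Pi.single 1 1)) - φ (Pi.single 1 1) * ρ (φ (Pi.single 0 1))) *
      Θ (φ (Pi.single 0 1) * ρ (φ (Pi.single 1 1)) - φ (Pi.single 1 1) * ρ (φ (Pi.single 0 1)))) = -1 := by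
  rw [← map_det_eq_of_lineModel _ jE φ hΘρ hform, det_antidiagonal_two, map_neg, map_one]

omit [Valued E ℤᵐ⁰] [Valued M ℤᵐ⁰] in
/-- **A-FRAME: `h′ρh′·Δ′ΘΔ′ = jE(dg₀·dg₁)`** — §2 at the diagonal plane `Matrix.diagonal dg`. [cite: Jacobowitz1962, §3] -/
theorem normRho_mul_normTheta_lineDisc_eq_map_prod {σ : E →+* E} (dg : Fin 2 → E) (jE : E →+* M) (φ : (Fin 2 → E) →+ M) {hM : M} (hΘρ : ∀ x, Θ (ρ x) = ρ (Θ x))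
    (hform : ∀ x y, jE (pairing σ (Matrix.diagonal dg) x y) = hM * Θ (φ x) * φ y + ρ (hM * Θ (φ x) * φ y)) :
    hM * ρ hM * ((φ (Pi.single 0 1) * ρ (φ (Pi.single 1 1)) - φ (Pi.single 1 1) * ρ (φ (Pi.single 0 1))) *
      Θ (φ (Pi.single 0 1) * ρ (φ (Pi.single 1 1)) - φ (Pi.single 1 1) * ρ (φ (Pi.single 0 1)))) = jE (dg 0 * dg 1) := by
  rw [← map_det_eq_of_lineModel _ jE φ hΘρ hform, Matrix.det_diagonal, Fin.prod_univ_two]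

/-! ## §3 The two frames differ by the non-norm class -/

omit [Valued E ℤᵐ⁰] [Valued M ℤᵐ⁰] in
/-- **THE HYPERBOLIC AND THE ANISOTROPIC FRAME SCALARS DIFFER BY THE NON-NORM CLASS: `(h′ρh′) ∕ (hρh) ∉ 𝒩`.**  Letters: `jE`-letters (`Fix ρ = jE(E)`, `Θ∘jE = jE∘σ`), `ρ² = 1`,
`Θρ = ρΘ`; the frame equation `formCongr σ P₁ Φ₃ = block(diagonal dg, η)` (`Φ₃ = (StdForm.antidiagonal 3).over E`) with `η ∉ N(E^×)`; line models `(φ, h)` of the hyperbolic plane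
`(StdForm.antidiagonal 2).over E` and `(φ′, h′)` of `Matrix.diagonal dg`.  PROOF: `dg₀ηdg₁ = −σ(det P₁)·det P₁` (★ `det_formCongr`, ★ `det_antidiagonal_three`, ★ `det_block_diagonal`);
§2: `hρh·ΔΘΔ = −1`, `h′ρh′·Δ′ΘΔ′ = jE(dg₀dg₁)`; hence `jE η = N_Θ(jE det P₁) · (hρh ∕ h′ρh′) · N_Θ(Δ ∕ Δ′)` and `Δ ∕ Δ′` is `ρ`-fixed — so `h′ρh′ ∕ hρh ∈ 𝒩` would make `jE η ∈ 𝒩`,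
i.e. `η ∈ N(E^×)` (★ `fixedNorm_map_iff`). [cite: Jacobowitz1962, §3] [cite: Serre1979, Ch. V §3 Prop. 5, Cor. 2–3 pp. 84–86] -/
theorem not_fixedNorm_frameRatio {σ : E →+* E} (jE : E →+* M) (hjfix : ∀ z, ρ z = z ↔ ∃ c, jE c = z) (hΘj : ∀ c, Θ (jE c) = jE (σ c))
    (hρρ : ∀ x, ρ (ρ x) = x) (hΘρ : ∀ x, Θ (ρ x) = ρ (Θ x)) (P₁ : GL (Fin 3) E) (dg : Fin 2 → E) (η : E)
    (hA : formCongr σ P₁ ((StdForm.antidiagonal 3).over E) =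
      (!![(Matrix.diagonal dg) 0 0, 0, (Matrix.diagonal dg) 0 1; 0, η, 0; (Matrix.diagonal dg) 1 0, 0, (Matrix.diagonal dg) 1 1] : Matrix (Fin 3) (Fin 3) E))
    (hηN : ¬ ∃ t : E, t * σ t = η)
    (φ : (Fin 2 → E) →+ M) {h : M} (hform : ∀ x y, jE (pairing σ ((StdForm.antidiagonal 2).over E) x y) = h * Θ (φ x) * φ y + ρ (h * Θ (φ x) * φ y))
    (φ' : (Fin 2 → E) →+ M) {h' : M} (hform' : ∀ x y, jE (pairing σ (Matrix.diagonal dg) x y) = h' * Θ (φ' x) * φ' y + ρ (h' * Θ (φ' x) * φ' y)) :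
    ¬ ∃ e : M, ρ e = e ∧ e * Θ e = h' * ρ h' / (h * ρ h) := by
  intro hrat
  have hρj : ∀ c : E, ρ (jE c) = jE c := fun c => (hjfix _).2 ⟨c, rfl⟩
  -- the determinant of the frame equation
  set p : E := (P₁ : Matrix (Fin 3) (Fin 3) E).det with hp
  have hdet : dg 0 * η * dg 1 = -(σ p * p) := by
    have h0 := congrArg Matrix.det hA
    rw [det_formCongr, det_antidiagonal_three, det_block_diagonal] at h0
    rw [← h0]; ring
  have hp0 : p ≠ 0 := (Matrix.isUnits_det_units P₁).ne_zero
  -- the two Gram determinants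
  set Δ : M := φ (Pi.single 0 1) * ρ (φ (Pi.single 1 1)) - φ (Pi.single 1 1) * ρ (φ (Pi.single 0 1)) with hΔ
  set Δ' : M := φ' (Pi.single 0 1) * ρ (φ' (Pi.single 1 1)) - φ' (Pi.single 1 1) * ρ (φ' (Pi.single 0 1)) with hΔ'
  have e1 : h * ρ h * (Δ * Θ Δ) = -1 := normRho_mul_normTheta_lineDisc_eq_neg_one jE φ hΘρ hform
  have e2 : h' * ρ h' * (Δ' * Θ Δ') = jE (dg 0 * dg 1) := normRho_mul_normTheta_lineDisc_eq_map_prod dg jE φ' hΘρ hform'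
  have hdg : dg 0 * dg 1 ≠ 0 := by
    intro h0
    have : σ p * p = 0 := by
      have e : dg 0 * η * dg 1 = (dg 0 * dg 1) * η := by ring
      rw [e, h0, zero_mul] at hdet
      exact neg_eq_zero.1 hdet.symm
    exact mul_ne_zero ((map_ne_zero σ).2 hp0) hp0 this
  have e2ne : h' * ρ h' * (Δ' * Θ Δ') ≠ 0 := by rw [e2]; exact (map_ne_zero jE).2 hdg
  have hhh' : h' * ρ h' ≠ 0 := left_ne_zero_of_mul e2ne
  have hN' : Δ' * Θ Δ' ≠ 0 := right_ne_zero_of_mul e2ne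
  have hΔ'0 : Δ' ≠ 0 := left_ne_zero_of_mul hN'
  have hhh : h * ρ h ≠ 0 := by
    intro h0; rw [h0, zero_mul] at e1; exact one_ne_zero (neg_eq_zero.1 e1.symm)
  -- `η` through `jE`
  have hηE : η = -(σ p * p) / (dg 0 * dg 1) := by
    rw [eq_div_iff hdg, ← hdet]; ring
  have hjη : jE η = (jE p * Θ (jE p)) * (h * ρ h / (h' * ρ h')) * (Δ / Δ' * Θ (Δ / Δ')) := by
    have eR : (jE p * Θ (jE p)) * (h * ρ h / (h' * ρ h')) * (Δ / Δ' * Θ (Δ / Δ')) =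
        (jE p * Θ (jE p)) * (h * ρ h * (Δ * Θ Δ)) / (h' * ρ h' * (Δ' * Θ Δ')) := by
      rw [map_div₀, div_mul_div_comm, mul_assoc (jE p * Θ (jE p)), div_mul_div_comm, ← mul_div_assoc]
    rw [eR, e1, e2, hηE, map_div₀, map_neg, map_mul, ← hΘj]
    ring
  -- the three factors are in `𝒩`
  have hf1 : ∃ e : M, ρ e = e ∧ e * Θ e = jE p * Θ (jE p) := ⟨jE p, hρj p, rfl⟩
  have hf2 : ∃ e : M, ρ e = e ∧ e * Θ e = h * ρ h / (h' * ρ h') := by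
    have := fixedNorm_inv hrat
    rwa [inv_div] at this
  have hf3 : ∃ e : M, ρ e = e ∧ e * Θ e = Δ / Δ' * Θ (Δ / Δ') :=
    ⟨Δ / Δ', by rw [map_div₀, hΔ, hΔ', map_lineDisc_eq_neg hρρ, map_lineDisc_eq_neg hρρ, neg_div_neg_eq], rfl⟩
  have hηN' : ∃ e : M, ρ e = e ∧ e * Θ e = jE η := by
    rw [hjη]; exact fixedNorm_mul (fixedNorm_mul hf1 hf2) hf3
  exact hηN ((fixedNorm_map_iff jE hjfix hΘj η).1 hηN')

/-! ## §4 HEAD (d′1) — the two literals' class conjuncts are complementary on every point of the line -/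

omit [Valued E ℤᵐ⁰] [Valued M ℤᵐ⁰] in
/-- The point `κ₀ + jE V₀·ξ₀` and its `ρ`-norm: with `Tr_ρ κ₀ = 1`, `Θκ₀ = κ₀`, `ρξ₀ = −ξ₀`, `Θξ₀ = ξ₀`, `σV₀ = V₀` (`Fix ρ ⊇ jE(E)`, `Θ∘jE = jE∘σ`, `Θρ = ρΘ`), the norm
`Q := κ·ρκ` is doubly fixed and NON-ZERO (a point of trace one is non-zero). [cite: Serre1979, Ch. V §3] -/
theorem normRho_point_letters {σ : E →+* E} (jE : E →+* M) (hρj : ∀ c, ρ (jE c) = jE c) (hΘj : ∀ c, Θ (jE c) = jE (σ c))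
    (hρρ : ∀ x, ρ (ρ x) = x) (hΘρ : ∀ x, Θ (ρ x) = ρ (Θ x))
    {κ₀ ξ₀ : M} (hκ₀ : κ₀ + ρ κ₀ = 1) (hΘκ₀ : Θ κ₀ = κ₀) (hξ : ρ ξ₀ = -ξ₀) (hΘξ : Θ ξ₀ = ξ₀) {V₀ : E} (hσV₀ : σ V₀ = V₀) :
    ρ ((κ₀ + jE V₀ * ξ₀) * ρ (κ₀ + jE V₀ * ξ₀)) = (κ₀ + jE V₀ * ξ₀) * ρ (κ₀ + jE V₀ * ξ₀) ∧
      Θ ((κ₀ + jE V₀ * ξ₀) * ρ (κ₀ + jE V₀ * ξ₀)) = (κ₀ + jE V₀ * ξ₀) * ρ (κ₀ + jE V₀ * ξ₀) ∧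
      (κ₀ + jE V₀ * ξ₀) * ρ (κ₀ + jE V₀ * ξ₀) ≠ 0 := by
  have hΘκ : Θ (κ₀ + jE V₀ * ξ₀) = κ₀ + jE V₀ * ξ₀ := by rw [map_add, map_mul, hΘκ₀, hΘj, hσV₀, hΘξ]
  have hκtr : (κ₀ + jE V₀ * ξ₀) + ρ (κ₀ + jE V₀ * ξ₀) = 1 := by rw [map_add, map_mul, hρj, hξ]; linear_combination hκ₀
  have hκ0 : κ₀ + jE V₀ * ξ₀ ≠ 0 := fun h0 => by rw [h0, map_zero, add_zero] at hκtr; exact zero_ne_one hκtr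
  refine ⟨by rw [map_mul, hρρ, mul_comm], by rw [map_mul, hΘρ, hΘκ], mul_ne_zero hκ0 ((map_ne_zero ρ).2 hκ0)⟩

omit [Valued M ℤᵐ⁰] in
/-- **HEAD (d′1) — «THE TWO LITERALS' CLASS CONJUNCTS ARE COMPLEMENTARY».**  CORE frame letters (`jE`-letters on a complete `E` with finite residue field and the wild datum
`IsRamifiedQuadraticDatum σ ϖ d tE` — for the index-two letters ★ p863914 §0 —, `ρ² = 1`, `Θρ = ρΘ`; the frame equation with `η ∉ N(E^×)`; line models `(φ, h)` of the hyperbolic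
plane and `(φ′, h′)` of `diagonal dg`); a point `κ = κ₀ + jE V₀·ξ₀` of the line (`Tr_ρ κ₀ = 1`, `Θκ₀ = κ₀`, `ρξ₀ = −ξ₀`, `Θξ₀ = ξ₀`, `σV₀ = V₀`).  THEN, in ★ p863983's bytes:
`(∃ e, ρe = e ∧ eΘe = κρκ ∕ (h′ρh′)) ↔ ¬ (∃ e, ρe = e ∧ eΘe = κρκ ∕ (hρh))` — a digit is of the anisotropic literal's class iff it is NOT of the hyperbolic literal's class.
[cite: Jacobowitz1962, §3] [cite: Serre1979, Ch. V §3 Prop. 5, Cor. 2–3 pp. 84–86] [cite: Flicker1998UnitaryFL, Prop. 7 p. 84] -/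
theorem classClause_iff_not_classClause [CompleteSpace E] [Finite 𝓀[E]] {σ : E →+* E} {ϖ : E} {d tE : ℕ} (hD : IsRamifiedQuadraticDatum σ ϖ d tE)
    (jE : E →+* M) (hjfix : ∀ z, ρ z = z ↔ ∃ c, jE c = z) (hΘj : ∀ c, Θ (jE c) = jE (σ c))
    (hρρ : ∀ x, ρ (ρ x) = x) (hΘρ : ∀ x, Θ (ρ x) = ρ (Θ x)) (P₁ : GL (Fin 3) E) (dg : Fin 2 → E) (η : E)
    (hA : formCongr σ P₁ ((StdForm.antidiagonal 3).over E) =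
      (!![(Matrix.diagonal dg) 0 0, 0, (Matrix.diagonal dg) 0 1; 0, η, 0; (Matrix.diagonal dg) 1 0, 0, (Matrix.diagonal dg) 1 1] : Matrix (Fin 3) (Fin 3) E))
    (hηN : ¬ ∃ t : E, t * σ t = η)
    (φ : (Fin 2 → E) →+ M) {h : M} (hform : ∀ x y, jE (pairing σ ((StdForm.antidiagonal 2).over E) x y) = h * Θ (φ x) * φ y + ρ (h * Θ (φ x) * φ y))
    (hΘh : Θ h = h) (hh : h ≠ 0)
    (φ' : (Fin 2 → E) →+ M) {h' : M} (hform' : ∀ x y, jE (pairing σ (Matrix.diagonal dg) x y) = h' * Θ (φ' x) * φ' y + ρ (h' * Θ (φ' x) * φ' y))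
    (hΘh' : Θ h' = h') (hh' : h' ≠ 0)
    {κ₀ ξ₀ : M} (hκ₀ : κ₀ + ρ κ₀ = 1) (hΘκ₀ : Θ κ₀ = κ₀) (hξ : ρ ξ₀ = -ξ₀) (hΘξ : Θ ξ₀ = ξ₀) {V₀ : E} (hσV₀ : σ V₀ = V₀) :
    (∃ e : M, ρ e = e ∧ e * Θ e = (κ₀ + jE V₀ * ξ₀) * ρ (κ₀ + jE V₀ * ξ₀) / (h' * ρ h')) ↔
      ¬ ∃ e : M, ρ e = e ∧ e * Θ e = (κ₀ + jE V₀ * ξ₀) * ρ (κ₀ + jE V₀ * ξ₀) / (h * ρ h) := by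
  have hρj : ∀ c : E, ρ (jE c) = jE c := fun c => (hjfix _).2 ⟨c, rfl⟩
  obtain ⟨c, hρc, hΘc, hcn, hdich⟩ := exists_indexTwo_letters (ρ := ρ) (Θ := Θ) hD jE hjfix hΘj
  obtain ⟨hρQ, hΘQ, hQ0⟩ := normRho_point_letters jE hρj hΘj hρρ hΘρ hκ₀ hΘκ₀ hξ hΘξ hσV₀
  have hrat := not_fixedNorm_frameRatio jE hjfix hΘj hρρ hΘρ P₁ dg η hA hηN φ hform φ' hform'
  have hρ₁ : ρ (h' * ρ h') = h' * ρ h' := by rw [map_mul, hρρ, mul_comm]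
  have hΘ₁ : Θ (h' * ρ h') = h' * ρ h' := by rw [map_mul, hΘρ, hΘh']
  have hρ₂ : ρ (h * ρ h) = h * ρ h := by rw [map_mul, hρρ, mul_comm]
  have hΘ₂ : Θ (h * ρ h) = h * ρ h := by rw [map_mul, hΘρ, hΘh]
  have h₁ : h' * ρ h' ≠ 0 := mul_ne_zero hh' ((map_ne_zero ρ).2 hh')
  have h₂ : h * ρ h ≠ 0 := mul_ne_zero hh ((map_ne_zero ρ).2 hh)
  -- `a₁ := h′ρh′`, `a₂ := hρh`: `a₂∕a₁ = hρh∕h′ρh′ ∉ 𝒩` (inverse of §3's ratio)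
  have h₁₂ : ¬ ∃ e : M, ρ e = e ∧ e * Θ e = h * ρ h / (h' * ρ h') := fun hh12 => hrat (by
    have := fixedNorm_inv hh12; rwa [inv_div] at this)
  exact fixedNorm_div_iff_not_fixedNorm_div hρc hΘc hcn hdich hρ₁ hΘ₁ h₁ hρ₂ hΘ₂ h₂ h₁₂ hρQ hΘQ hQ0

omit [Valued M ℤᵐ⁰] in
/-- **EVERY DIGIT IS OF ONE OF THE TWO CLASSES** (frame of `classClause_iff_not_classClause`): `CLASS_h(V₀) ∨ CLASS_{h′}(V₀)` — the class half of the spine's `hcov`.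
[cite: Serre1979, Ch. V §3 Prop. 5, Cor. 2–3 pp. 84–86] -/
theorem classClause_or [CompleteSpace E] [Finite 𝓀[E]] {σ : E →+* E} {ϖ : E} {d tE : ℕ} (hD : IsRamifiedQuadraticDatum σ ϖ d tE)
    (jE : E →+* M) (hjfix : ∀ z, ρ z = z ↔ ∃ c, jE c = z) (hΘj : ∀ c, Θ (jE c) = jE (σ c))
    (hρρ : ∀ x, ρ (ρ x) = x) (hΘρ : ∀ x, Θ (ρ x) = ρ (Θ x)) (P₁ : GL (Fin 3) E) (dg : Fin 2 → E) (η : E)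
    (hA : formCongr σ P₁ ((StdForm.antidiagonal 3).over E) =
      (!![(Matrix.diagonal dg) 0 0, 0, (Matrix.diagonal dg) 0 1; 0, η, 0; (Matrix.diagonal dg) 1 0, 0, (Matrix.diagonal dg) 1 1] : Matrix (Fin 3) (Fin 3) E))
    (hηN : ¬ ∃ t : E, t * σ t = η)
    (φ : (Fin 2 → E) →+ M) {h : M} (hform : ∀ x y, jE (pairing σ ((StdForm.antidiagonal 2).over E) x y) = h * Θ (φ x) * φ y + ρ (h * Θ (φ x) * φ y))
    (hΘh : Θ h = h) (hh : h ≠ 0)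
    (φ' : (Fin 2 → E) →+ M) {h' : M} (hform' : ∀ x y, jE (pairing σ (Matrix.diagonal dg) x y) = h' * Θ (φ' x) * φ' y + ρ (h' * Θ (φ' x) * φ' y))
    (hΘh' : Θ h' = h') (hh' : h' ≠ 0)
    {κ₀ ξ₀ : M} (hκ₀ : κ₀ + ρ κ₀ = 1) (hΘκ₀ : Θ κ₀ = κ₀) (hξ : ρ ξ₀ = -ξ₀) (hΘξ : Θ ξ₀ = ξ₀) {V₀ : E} (hσV₀ : σ V₀ = V₀) :
    (∃ e : M, ρ e = e ∧ e * Θ e = (κ₀ + jE V₀ * ξ₀) * ρ (κ₀ + jE V₀ * ξ₀) / (h * ρ h)) ∨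
      ∃ e : M, ρ e = e ∧ e * Θ e = (κ₀ + jE V₀ * ξ₀) * ρ (κ₀ + jE V₀ * ξ₀) / (h' * ρ h') := by
  by_cases hH : ∃ e : M, ρ e = e ∧ e * Θ e = (κ₀ + jE V₀ * ξ₀) * ρ (κ₀ + jE V₀ * ξ₀) / (h * ρ h)
  · exact Or.inl hH
  · exact Or.inr ((classClause_iff_not_classClause hD jE hjfix hΘj hρρ hΘρ P₁ dg η hA hηN φ hform hΘh hh φ' hform' hΘh' hh' hκ₀ hΘκ₀ hξ hΘξ hσV₀).2 hH)

omit [Valued M ℤᵐ⁰] in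
/-- **FINSET FORM (the spine's `hdisjHA`)**: frame of `classClause_iff_not_classClause`; a `σ`-fixed digit system `Rd`; ANY cell predicates `P, P′` and labels `NX, NX′`.  THEN the
labelled H-class digits `((Rd.filter fun V ↦ P V ∧ CLASS_h V).filter NX)` and the labelled A-class digits `((Rd.filter fun V ↦ P′ V ∧ CLASS_{h′} V).filter NX′)` are DISJOINT.
[cite: Serre1979, Ch. V §3 Prop. 5, Cor. 2–3 pp. 84–86] [cite: Kottwitz1986BaseChangeUnits, §1 pp. 240–241] -/
theorem disjoint_filter_class_filter_class [CompleteSpace E] [Finite 𝓀[E]] {σ : E →+* E} {ϖ : E} {d tE : ℕ} (hD : IsRamifiedQuadraticDatum σ ϖ d tE)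
    (jE : E →+* M) (hjfix : ∀ z, ρ z = z ↔ ∃ c, jE c = z) (hΘj : ∀ c, Θ (jE c) = jE (σ c))
    (hρρ : ∀ x, ρ (ρ x) = x) (hΘρ : ∀ x, Θ (ρ x) = ρ (Θ x)) (P₁ : GL (Fin 3) E) (dg : Fin 2 → E) (η : E)
    (hA : formCongr σ P₁ ((StdForm.antidiagonal 3).over E) =
      (!![(Matrix.diagonal dg) 0 0, 0, (Matrix.diagonal dg) 0 1; 0, η, 0; (Matrix.diagonal dg) 1 0, 0, (Matrix.diagonal dg) 1 1] : Matrix (Fin 3) (Fin 3) E))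
    (hηN : ¬ ∃ t : E, t * σ t = η)
    (φ : (Fin 2 → E) →+ M) {h : M} (hform : ∀ x y, jE (pairing σ ((StdForm.antidiagonal 2).over E) x y) = h * Θ (φ x) * φ y + ρ (h * Θ (φ x) * φ y))
    (hΘh : Θ h = h) (hh : h ≠ 0)
    (φ' : (Fin 2 → E) →+ M) {h' : M} (hform' : ∀ x y, jE (pairing σ (Matrix.diagonal dg) x y) = h' * Θ (φ' x) * φ' y + ρ (h' * Θ (φ' x) * φ' y))
    (hΘh' : Θ h' = h') (hh' : h' ≠ 0)
    {κ₀ ξ₀ : M} (hκ₀ : κ₀ + ρ κ₀ = 1) (hΘκ₀ : Θ κ₀ = κ₀) (hξ : ρ ξ₀ = -ξ₀) (hΘξ : Θ ξ₀ = ξ₀)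
    (Rd : Finset E) (hRdσ : ∀ V ∈ Rd, σ V = V) (P P' NX NX' : E → Prop) [DecidablePred NX] [DecidablePred NX']
    [DecidablePred fun V => P V ∧ ∃ e : M, ρ e = e ∧ e * Θ e = (κ₀ + jE V * ξ₀) * ρ (κ₀ + jE V * ξ₀) / (h * ρ h)]
    [DecidablePred fun V => P' V ∧ ∃ e : M, ρ e = e ∧ e * Θ e = (κ₀ + jE V * ξ₀) * ρ (κ₀ + jE V * ξ₀) / (h' * ρ h')] :
    Disjoint ((Rd.filter fun V => P V ∧ ∃ e : M, ρ e = e ∧ e * Θ e = (κ₀ + jE V * ξ₀) * ρ (κ₀ + jE V * ξ₀) / (h * ρ h)).filter NX)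
      ((Rd.filter fun V => P' V ∧ ∃ e : M, ρ e = e ∧ e * Θ e = (κ₀ + jE V * ξ₀) * ρ (κ₀ + jE V * ξ₀) / (h' * ρ h')).filter NX') := by
  rw [Finset.disjoint_left]
  intro V hV hV'
  obtain ⟨hV1, -⟩ := Finset.mem_filter.1 hV
  obtain ⟨hVR, -, hH⟩ := Finset.mem_filter.1 hV1
  obtain ⟨hV1', -⟩ := Finset.mem_filter.1 hV'
  obtain ⟨-, -, hA'⟩ := Finset.mem_filter.1 hV1'
  exact (classClause_iff_not_classClause hD jE hjfix hΘj hρρ hΘρ P₁ dg η hA hηN φ hform hΘh hh φ' hform' hΘh' hh' hκ₀ hΘκ₀ hξ hΘξ (hRdσ V hVR)).1 hA' hH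

/-! ## §5 HEAD (d′2) — far towers are of the hyperbolic class -/

/-- **HEAD (d′2) — «FAR TOWERS ARE ONE-CLASS (HYPERBOLIC)».**  `jE`-letters on a complete `E` with the wild datum `IsRamifiedQuadraticDatum σ ϖ d tE` (`|jE a| = |a|`); `ρ` an isometric
involution commuting with `Θ`; a line model `(φ, h)` of the hyperbolic plane `(StdForm.antidiagonal 2).over E`; a `Θ`-fixed base point `κ₀` with `|κ₀| = 1` (its trace is not used); a direction `ξ₀`
(`ρξ₀ = −ξ₀`, `Θξ₀ = ξ₀`); a `σ`-fixed digit `V₀` on a FAR shell: `exp(2d − 1) ≤ |V₀|·|ξ₀|` (cells `b + 2i` with `d ≤ i` in the chart of ★ p864361 §7).  THEN the digit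
`κ = κ₀ + jE V₀·ξ₀` is of the hyperbolic class: `∃ e, ρe = e ∧ eΘe = κρκ ∕ (hρh)`.  (`κρκ = −(jE V₀ξ₀)²·u`, `|u − 1| ≤ 1∕|V₀ξ₀| ≤ |ϖE|^{2d−1}` ⇒ `u ∈ 𝒩` by ★ Lit
`exists_mul_map_eq_of_fixed_of_v_sub_one_le_pred`; `−1∕(hρh) = ΔΘΔ` (§2); `κρκ∕(hρh) = u·N_Θ(jE V₀)·N_Θ(ξ₀Δ)`, `ξ₀Δ ∈ Fix ρ`.)
[cite: Serre1979, Ch. V §3 Prop. 5, Cor. 2–3 pp. 84–86; Ch. XV §2] [cite: Jacobowitz1962, §3] [cite: Flicker1998UnitaryFL, Prop. 7 p. 84] -/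
theorem classClause_of_far [CompleteSpace E] {σ : E →+* E} {ϖ : E} {d tE : ℕ} (hD : IsRamifiedQuadraticDatum σ ϖ d tE)
    (jE : E →+* M) (hjfix : ∀ z, ρ z = z ↔ ∃ c, jE c = z) (hΘj : ∀ c, Θ (jE c) = jE (σ c)) (hjiso : ∀ a, Valued.v (jE a) = Valued.v a)
    (hρρ : ∀ x, ρ (ρ x) = x) (hvρ : ∀ x, Valued.v (ρ x) = Valued.v x) (hΘρ : ∀ x, Θ (ρ x) = ρ (Θ x))
    (φ : (Fin 2 → E) →+ M) {h : M} (hform : ∀ x y, jE (pairing σ ((StdForm.antidiagonal 2).over E) x y) = h * Θ (φ x) * φ y + ρ (h * Θ (φ x) * φ y))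
    {κ₀ ξ₀ : M} (hΘκ₀ : Θ κ₀ = κ₀) (hκ₀1 : Valued.v κ₀ = 1) (hξ : ρ ξ₀ = -ξ₀) (hΘξ : Θ ξ₀ = ξ₀)
    {V₀ : E} (hσV₀ : σ V₀ = V₀) (hfar : exp (2 * (d : ℤ) - 1) ≤ Valued.v V₀ * Valued.v ξ₀) :
    ∃ e : M, ρ e = e ∧ e * Θ e = (κ₀ + jE V₀ * ξ₀) * ρ (κ₀ + jE V₀ * ξ₀) / (h * ρ h) := by
  obtain ⟨-, -, hϖ, -, -, hd1, -⟩ := id hD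
  have hρj : ∀ c : E, ρ (jE c) = jE c := fun c => (hjfix _).2 ⟨c, rfl⟩
  set W : M := jE V₀ * ξ₀ with hWdef
  have hρW : ρ W = -W := by rw [hWdef, map_mul, hρj, hξ, mul_neg]
  have hΘW : Θ W = W := by rw [hWdef, map_mul, hΘj, hσV₀, hΘξ]
  -- sizes: `|W| ≥ exp(2d − 1) > 1`
  have hWv : Valued.v W = Valued.v V₀ * Valued.v ξ₀ := by rw [hWdef, Valuation.map_mul, hjiso]
  have hWge : exp (2 * (d : ℤ) - 1) ≤ Valued.v W := by rw [hWv]; exact hfar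
  have hW1 : 1 < Valued.v W := lt_of_lt_of_le (by rw [← exp_zero, exp_lt_exp]; omega) hWge
  have hW0 : W ≠ 0 := fun h0 => by rw [h0, Valuation.map_zero] at hW1; exact not_lt.2 zero_le hW1
  have hWpos : 0 < Valued.v W := lt_trans zero_lt_one hW1
  -- the unit `u := −κρκ ∕ W²`; `u − 1 = −(κ₀ρκ₀ − W(κ₀ − ρκ₀)) ∕ W²`
  set κ : M := κ₀ + W with hκdef
  have hρκ : ρ κ = ρ κ₀ - W := by rw [hκdef, map_add, hρW]; ring
  set u : M := -(κ * ρ κ) / (W * W) with hudef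
  have hW2 : W * W ≠ 0 := mul_ne_zero hW0 hW0
  have hu1 : u - 1 = -(κ₀ * ρ κ₀ - W * (κ₀ - ρ κ₀)) / (W * W) := by
    rw [hudef, hρκ, hκdef, eq_div_iff hW2]
    field_simp
    ring
  have hnum : Valued.v (κ₀ * ρ κ₀ - W * (κ₀ - ρ κ₀)) ≤ Valued.v W := by
    refine (Valuation.map_sub _ _ _).trans (max_le ?_ ?_)
    · rw [Valuation.map_mul, hvρ, hκ₀1, one_mul]; exact hW1.le
    · rw [Valuation.map_mul]
      calc Valued.v W * Valued.v (κ₀ - ρ κ₀) ≤ Valued.v W * 1 := by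
            gcongr
            exact (Valuation.map_sub _ _ _).trans (max_le hκ₀1.le (by rw [hvρ, hκ₀1]))
        _ = Valued.v W := mul_one _
  have huv : Valued.v (u - 1) ≤ Valued.v (jE ϖ) ^ (2 * d - 1) := by
    rw [hu1, map_div₀, Valuation.map_neg, Valuation.map_mul]
    have hle : Valued.v (κ₀ * ρ κ₀ - W * (κ₀ - ρ κ₀)) / (Valued.v W * Valued.v W) ≤ (Valued.v W)⁻¹ := by
      rw [div_le_iff₀ (mul_pos hWpos hWpos)]
      calc Valued.v (κ₀ * ρ κ₀ - W * (κ₀ - ρ κ₀)) ≤ Valued.v W := hnum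
        _ = (Valued.v W)⁻¹ * (Valued.v W * Valued.v W) := by field_simp
    refine hle.trans ?_
    rw [hjiso, hϖ, ← exp_nsmul, nsmul_eq_mul, inv_le_comm₀ hWpos exp_pos, ← exp_neg]
    refine le_trans (by rw [exp_le_exp]; omega) hWge
  -- `u` is doubly fixed, hence `u = jE u_E` with `σ u_E = u_E`, and `u ∈ 𝒩` by the conductor lemma on `E`
  have hρu : ρ u = u := by
    rw [hudef, map_div₀, map_neg, map_mul, map_mul, hρρ, hρW, mul_comm (ρ κ) κ, neg_mul_neg]
  have hΘκ : Θ κ = κ := by rw [hκdef, map_add, hΘκ₀, hΘW]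
  have hΘu : Θ u = u := by rw [hudef, map_div₀, map_neg, map_mul, map_mul, hΘκ, hΘρ, hΘκ, hΘW]
  obtain ⟨uE, huE⟩ := (hjfix u).1 hρu
  have hσuE : σ uE = uE := jE.injective (by rw [← hΘj, huE, hΘu])
  have huEv : Valued.v (uE - 1) ≤ Valued.v ϖ ^ (2 * d - 1) := by
    rw [← hjiso, map_sub, map_one, huE, ← hjiso ϖ]; exact huv
  obtain ⟨t, ht⟩ := exists_mul_map_eq_of_fixed_of_v_sub_one_le_pred hD hσuE le_rfl huEv
  have huN : ∃ e : M, ρ e = e ∧ e * Θ e = u := by rw [← huE]; exact (fixedNorm_map_iff jE hjfix hΘj uE).2 ⟨t, ht⟩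
  -- `−1∕(hρh) = ΔΘΔ` and the factorisation of `κρκ ∕ (hρh)`
  set Δ : M := φ (Pi.single 0 1) * ρ (φ (Pi.single 1 1)) - φ (Pi.single 1 1) * ρ (φ (Pi.single 0 1)) with hΔ
  have e1 : h * ρ h * (Δ * Θ Δ) = -1 := normRho_mul_normTheta_lineDisc_eq_neg_one jE φ hΘρ hform
  have hhh : h * ρ h ≠ 0 := by
    intro h0; rw [h0, zero_mul] at e1; exact one_ne_zero (neg_eq_zero.1 e1.symm)
  have hfac : κ * ρ κ / (h * ρ h) = u * (jE V₀ * Θ (jE V₀)) * ((ξ₀ * Δ) * Θ (ξ₀ * Δ)) := by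
    have eκ : κ * ρ κ = -(u * (W * W)) := by rw [hudef, div_mul_cancel₀ _ hW2]; ring
    rw [eκ, div_eq_iff hhh, map_mul, hΘξ, hΘj, hσV₀, hWdef]
    linear_combination (-(u * (jE V₀ * ξ₀) * (jE V₀ * ξ₀))) * e1
  have hf2 : ∃ e : M, ρ e = e ∧ e * Θ e = jE V₀ * Θ (jE V₀) := ⟨jE V₀, hρj V₀, rfl⟩
  have hf3 : ∃ e : M, ρ e = e ∧ e * Θ e = (ξ₀ * Δ) * Θ (ξ₀ * Δ) :=
    ⟨ξ₀ * Δ, by rw [map_mul, hξ, hΔ, map_lineDisc_eq_neg hρρ, neg_mul_neg], rfl⟩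
  rw [hfac]
  exact fixedNorm_mul (fixedNorm_mul huN hf2) hf3

/-- **NO ANISOTROPIC-CLASS DIGIT ON A FAR TOWER** (§5 × §4): the full CORE frame of `classClause_iff_not_classClause` plus the far-shell letter `exp(2d − 1) ≤ |V₀|·|ξ₀|` and `|κ₀| = 1`
⟹ `¬ ∃ e, ρe = e ∧ eΘe = κρκ ∕ (h′ρh′)` — the A-literal's class conjunct FAILS at every far digit, so ★ p864238 §2′'s A-window `IA = range (min (…) d)` covers the A-digits
(`hwinA`). [cite: Serre1979, Ch. V §3 Prop. 5, Cor. 2–3 pp. 84–86; Ch. XV §2] [cite: Jacobowitz1962, §3] [cite: Flicker1998UnitaryFL, Prop. 7 p. 84] -/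
theorem not_classClause'_of_far [CompleteSpace E] [Finite 𝓀[E]] {σ : E →+* E} {ϖ : E} {d tE : ℕ} (hD : IsRamifiedQuadraticDatum σ ϖ d tE)
    (jE : E →+* M) (hjfix : ∀ z, ρ z = z ↔ ∃ c, jE c = z) (hΘj : ∀ c, Θ (jE c) = jE (σ c)) (hjiso : ∀ a, Valued.v (jE a) = Valued.v a)
    (hρρ : ∀ x, ρ (ρ x) = x) (hvρ : ∀ x, Valued.v (ρ x) = Valued.v x) (hΘρ : ∀ x, Θ (ρ x) = ρ (Θ x))
    (P₁ : GL (Fin 3) E) (dg : Fin 2 → E) (η : E)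
    (hA : formCongr σ P₁ ((StdForm.antidiagonal 3).over E) =
      (!![(Matrix.diagonal dg) 0 0, 0, (Matrix.diagonal dg) 0 1; 0, η, 0; (Matrix.diagonal dg) 1 0, 0, (Matrix.diagonal dg) 1 1] : Matrix (Fin 3) (Fin 3) E))
    (hηN : ¬ ∃ t : E, t * σ t = η)
    (φ : (Fin 2 → E) →+ M) {h : M} (hform : ∀ x y, jE (pairing σ ((StdForm.antidiagonal 2).over E) x y) = h * Θ (φ x) * φ y + ρ (h * Θ (φ x) * φ y))
    (hΘh : Θ h = h) (hh : h ≠ 0)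
    (φ' : (Fin 2 → E) →+ M) {h' : M} (hform' : ∀ x y, jE (pairing σ (Matrix.diagonal dg) x y) = h' * Θ (φ' x) * φ' y + ρ (h' * Θ (φ' x) * φ' y))
    (hΘh' : Θ h' = h') (hh' : h' ≠ 0)
    {κ₀ ξ₀ : M} (hκ₀ : κ₀ + ρ κ₀ = 1) (hΘκ₀ : Θ κ₀ = κ₀) (hκ₀1 : Valued.v κ₀ = 1) (hξ : ρ ξ₀ = -ξ₀) (hΘξ : Θ ξ₀ = ξ₀)
    {V₀ : E} (hσV₀ : σ V₀ = V₀) (hfar : exp (2 * (d : ℤ) - 1) ≤ Valued.v V₀ * Valued.v ξ₀) :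
    ¬ ∃ e : M, ρ e = e ∧ e * Θ e = (κ₀ + jE V₀ * ξ₀) * ρ (κ₀ + jE V₀ * ξ₀) / (h' * ρ h') := fun hA' =>
  (classClause_iff_not_classClause hD jE hjfix hΘj hρρ hΘρ P₁ dg η hA hηN φ hform hΘh hh φ' hform' hΘh' hh' hκ₀ hΘκ₀ hξ hΘξ hσV₀).1 hA'
    (classClause_of_far hD jE hjfix hΘj hjiso hρρ hvρ hΘρ φ hform hΘκ₀ hκ₀1 hξ hΘξ hσV₀ hfar)

end Summit.HodgeConjecture.HodgeConjecture.Cruxes.H413.F0P3cDyRamRowCellDigitClassSplit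

end
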